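import Summits.Parity.GeneralizedHardyLittlewood.Theorems.LeeYangFibresRelativeDimOneMoebiusSplitLatticeCount
import Literature.NumberTheory.Sieve.LinearEquationsInPrimesDimOne
import Literature.NumberTheory.Sieve.LinearEquationsInPrimesCrudeBounds
import Mathlib
import HarnessLib

/-!
# Route `LeeYangFibres`, crux `RelativeDimOne` (stmt-Parity-14113), line `single-moebius-split`,
# stub `stub_termBound` — auxiliary file 1: pointwise identities for `Λ − Λ_R` and `Λ_R`

Elementary identities and crude bounds used by the reduction of term `j ≥ 1` of the telescoping to
the single-Möbius hybrid atom (`stub_termBound`):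

* `sum_filter_latticeBox_dimOne` — sums over the box `[-N, N]¹` are sums over `[-N, N] ⊆ ℤ`;
* `prod_Ioi_lambdaR_eq_sum` — the truncated factors `i > j` expanded over tuples of divisors (from
  the line's `lambdaR_eq_sum_Icc`, file `…MoebiusSplitLatticeCount`);
* `termBound_aux_vonMangoldt_sub_lambdaR` — for `m ≥ 2`:
  `(Λ − Λ_R)(m) = −∑_{1 ≤ e ≤ E} [e ∣ m ∧ R e < m] μ(m/e) log(m/(eR))` (open the von Mangoldt
  factor, `Λ = −μ log ⋆ 1`, and pass to the complementary divisor `e = m/d`, `d > R`);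
* `intVonMangoldt_sub_lambdaR_one` — `(Λ − Λ_R)(1) = −log R`;
* the crude bound `|Λ_R(m)| ≤ R log R` (and `Λ(m) = 0` for `m ≤ 0`).
-/

noncomputable section

open scoped BigOperators Classical
open Finset Literature.NumberTheory.Sieve

namespace Summit.Parity.GeneralizedHardyLittlewood.Cruxes.RelativeDimOne.SingleMoebiusSplit

/-! ### Sums over the one-dimensional box -/

/-- Sums over the box `[-N, N]¹` are sums over the integer interval `[-N, N]` (`n ↦ n₀`,
`m ↦ (m)`). -/
theorem sum_filter_latticeBox_dimOne (N : ℕ) (Q : (Fin 1 → ℤ) → Prop) (g : (Fin 1 → ℤ) → ℝ) :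
    ∑ n ∈ (latticeBox 1 N).filter Q, g n =
      ∑ m ∈ (Finset.Icc (-(N : ℤ)) N).filter (fun m => Q (fun _ => m)), g (fun _ => m) := by
  -- adapted from `Literature.NumberTheory.Sieve.DimOne.card_filter_latticeBox`
  refine Finset.sum_nbij' (fun n => n 0) (fun m _ => m) (fun n hn => ?_) (fun m hm => ?_)
    (fun n _ => ?_) (fun m _ => rfl) (fun n _ => ?_)
  · rw [Finset.mem_filter] at hn ⊢
    have h1 : n = fun _ => n 0 := by funext i; rw [Fin.fin_one_eq_zero i]
    refine ⟨?_, h1 ▸ hn.2⟩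
    exact Finset.mem_Icc.mpr (Finset.mem_Icc.mp (Fintype.mem_piFinset.mp hn.1 0))
  · rw [Finset.mem_filter] at hm ⊢
    exact ⟨Fintype.mem_piFinset.mpr fun _ => hm.1, hm.2⟩
  · funext i; simp [Fin.fin_one_eq_zero i]
  · congr 1; funext i; rw [Fin.fin_one_eq_zero i]

/-! ### The von Mangoldt function on `ℤ`: crude bounds -/

/-- `Λ(m) = 0` for `m ≤ 0`. -/
theorem intVonMangoldt_of_nonpos {m : ℤ} (hm : m ≤ 0) : intVonMangoldt m = 0 := by
  unfold intVonMangoldt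
  rw [Int.toNat_eq_zero.mpr hm, ArithmeticFunction.map_zero]

/-! ### The truncated divisor sum `Λ_R` -/

/-- **Crude bound** `|Λ_R(m)| ≤ ⌊R⌋ log R` for `R ≥ 1` (at most `⌊R⌋` terms, each in `[0, log R]`). -/
theorem abs_lambdaR_le {R : ℝ} (hR : 1 ≤ R) (m : ℤ) : |lambdaR R m| ≤ ⌊R⌋₊ * Real.log R := by
  unfold lambdaR
  have hR0 : 0 < R := by linarith
  set s := (Nat.divisors m.toNat).filter (fun d : ℕ => (d : ℝ) ≤ R) with hs
  have hterm : ∀ d ∈ s, |((ArithmeticFunction.moebius d : ℤ) : ℝ) * Real.log (R / d)| ≤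
      Real.log R := by
    intro d hd
    rw [hs, Finset.mem_filter] at hd
    have hd1 : 1 ≤ d := Nat.pos_of_mem_divisors hd.1
    have hd1' : (1 : ℝ) ≤ d := by exact_mod_cast hd1
    have hd0 : (0 : ℝ) < d := by linarith
    rw [abs_mul]
    have hμ : |((ArithmeticFunction.moebius d : ℤ) : ℝ)| ≤ 1 := by
      rw [← Int.cast_abs]
      exact_mod_cast ArithmeticFunction.abs_moebius_le_one
    have hlog0 : 0 ≤ Real.log (R / d) := Real.log_nonneg ((one_le_div hd0).mpr hd.2)
    have hlog : Real.log (R / d) ≤ Real.log R := by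
      rw [Real.log_div hR0.ne' hd0.ne']
      linarith [Real.log_nonneg hd1']
    rw [abs_of_nonneg hlog0]
    calc _ ≤ 1 * Real.log (R / d) := mul_le_mul_of_nonneg_right hμ hlog0
      _ ≤ Real.log R := by rw [one_mul]; exact hlog
  have hcard : s.card ≤ ⌊R⌋₊ := by
    calc s.card ≤ (Finset.Icc 1 ⌊R⌋₊).card := by
          refine Finset.card_le_card fun d hd => ?_
          rw [hs, Finset.mem_filter] at hd
          exact Finset.mem_Icc.mpr ⟨Nat.pos_of_mem_divisors hd.1, (Nat.le_floor_iff hR0.le).mpr hd.2⟩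
      _ = ⌊R⌋₊ := by rw [Nat.card_Icc, Nat.add_sub_cancel]
  calc |∑ d ∈ s, ((ArithmeticFunction.moebius d : ℤ) : ℝ) * Real.log (R / d)|
      ≤ ∑ d ∈ s, |((ArithmeticFunction.moebius d : ℤ) : ℝ) * Real.log (R / d)| :=
        Finset.abs_sum_le_sum_abs _ _
    _ ≤ ∑ _d ∈ s, Real.log R := Finset.sum_le_sum hterm
    _ = s.card * Real.log R := by rw [Finset.sum_const, nsmul_eq_mul]
    _ ≤ ⌊R⌋₊ * Real.log R :=
        mul_le_mul_of_nonneg_right (by exact_mod_cast hcard) (Real.log_nonneg hR)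

/-- `(Λ − Λ_R)(1) = −log R` for `R ≥ 1` (`Λ(1) = 0`, `Λ_R(1) = μ(1) log R`). -/
theorem intVonMangoldt_sub_lambdaR_one {R : ℝ} (hR : 1 ≤ R) :
    intVonMangoldt 1 - lambdaR R 1 = -Real.log R := by
  unfold intVonMangoldt lambdaR
  have h1 : (1 : ℤ).toNat = 1 := rfl
  rw [h1, ArithmeticFunction.vonMangoldt_apply_one, Nat.divisors_one,
    Finset.filter_singleton, if_pos (by exact_mod_cast hR), Finset.sum_singleton]
  simp


/-! ### Opening the von Mangoldt factor: `(Λ − Λ_R)(m)` for `m ≥ 2` -/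

/-- `∑_{d ∣ n} μ(d) = [n = 1]` (real-valued; Mathlib's `μ * ζ = 1`). -/
theorem sum_divisors_moebius_real (n : ℕ) :
    ∑ d ∈ n.divisors, ((ArithmeticFunction.moebius d : ℤ) : ℝ) = if n = 1 then 1 else 0 := by
  -- adapted from `Literature.NumberTheory.Sieve.sum_divisors_moebius_eq_ite`
  have h := congrArg (fun f : ArithmeticFunction ℝ => f n)
    (ArithmeticFunction.coe_moebius_mul_coe_zeta (R := ℝ))
  simpa only [ArithmeticFunction.coe_mul_zeta_apply, ArithmeticFunction.intCoe_apply,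
    ArithmeticFunction.one_apply] using h

/-- For `n ≥ 2`: `Λ(n) − Λ_R(n) = −∑_{d ∣ n, d > R} μ(d) (log d − log R)` (`Λ = −∑_{d∣n} μ(d) log d`,
`∑_{d ∣ n} μ(d) = 0`). -/
theorem intVonMangoldt_sub_lambdaR_eq_sum_divisors {R : ℝ} (hR : 0 < R) {n : ℕ} (hn : 2 ≤ n) :
    intVonMangoldt (n : ℤ) - lambdaR R (n : ℤ) =
      -∑ d ∈ n.divisors, if R < (d : ℝ) then
        ((ArithmeticFunction.moebius d : ℤ) : ℝ) * (Real.log d - Real.log R) else 0 := by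
  have hΛ : intVonMangoldt (n : ℤ) =
      -∑ d ∈ n.divisors, ((ArithmeticFunction.moebius d : ℤ) : ℝ) * Real.log d := by
    unfold intVonMangoldt
    rw [Int.toNat_natCast]
    have h := ArithmeticFunction.sum_moebius_mul_log_eq (n := n)
    simp only [ArithmeticFunction.log_apply] at h
    linarith
  have hΛR : lambdaR R (n : ℤ) = ∑ d ∈ n.divisors, if (d : ℝ) ≤ R then
      ((ArithmeticFunction.moebius d : ℤ) : ℝ) * (Real.log R - Real.log d) else 0 := by
    unfold lambdaR
    rw [Int.toNat_natCast, ← Finset.sum_filter]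
    refine Finset.sum_congr rfl fun d hd => ?_
    have hd0 : (0 : ℝ) < d := by
      exact_mod_cast Nat.pos_of_mem_divisors (Finset.mem_filter.mp hd).1
    rw [Real.log_div hR.ne' hd0.ne']
  have hμ0 : ∑ d ∈ n.divisors, ((ArithmeticFunction.moebius d : ℤ) : ℝ) = 0 := by
    rw [sum_divisors_moebius_real, if_neg (by omega)]
  have key : ∀ d : ℕ, -(((ArithmeticFunction.moebius d : ℤ) : ℝ) * Real.log d) -
      (if (d : ℝ) ≤ R then ((ArithmeticFunction.moebius d : ℤ) : ℝ) * (Real.log R - Real.log d)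
        else 0) =
      -(if R < (d : ℝ) then ((ArithmeticFunction.moebius d : ℤ) : ℝ) * (Real.log d - Real.log R)
        else 0) - ((ArithmeticFunction.moebius d : ℤ) : ℝ) * Real.log R := by
    intro d
    by_cases h : (d : ℝ) ≤ R
    · rw [if_pos h, if_neg (not_lt.mpr h)]; ring
    · rw [if_neg h, if_pos (lt_of_not_ge h)]; ring
  rw [hΛ, hΛR, ← Finset.sum_neg_distrib, ← Finset.sum_sub_distrib, Finset.sum_congr rfl
    (fun d _ => key d), Finset.sum_sub_distrib, ← Finset.sum_mul, hμ0, zero_mul, sub_zero,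
    Finset.sum_neg_distrib]

/-- **Opening one von Mangoldt factor** (registered sub-goal for `stub_termBound`). For `R > 0`,
`m ≥ 2` and `m ≤ R E`:
`(Λ − Λ_R)(m) = −∑_{1 ≤ e ≤ E} [e ∣ m ∧ R e < m] μ(m/e) log(m/(eR))` — the Möbius variable is the
complementary divisor `d = m/e > R`, and `e < m/R ≤ E`. -/
theorem termBound_aux_vonMangoldt_sub_lambdaR : ∀ (R : ℝ), 0 < R → ∀ (m : ℤ), 2 ≤ m →
    ∀ (E : ℕ), (m : ℝ) ≤ R * E →
    intVonMangoldt m - lambdaR R m =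
      -∑ e ∈ Finset.Icc 1 E, if ((e : ℤ) ∣ m ∧ R * e < (m : ℝ)) then
        (ArithmeticFunction.moebius (m / e).toNat : ℝ) * Real.log ((m : ℝ) / (e * R)) else 0 := by
  intro R hR m hm E hE
  obtain ⟨n, rfl⟩ : ∃ n : ℕ, m = n := ⟨m.toNat, (Int.toNat_of_nonneg (by omega)).symm⟩
  have hn2 : 2 ≤ n := by exact_mod_cast hm
  have hn0 : n ≠ 0 := by omega
  have hnR : (n : ℝ) ≤ R * E := by exact_mod_cast hE
  rw [intVonMangoldt_sub_lambdaR_eq_sum_divisors hR hn2, ← Nat.sum_div_divisors n]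
  congr 1
  -- pass from `e ∈ divisors n` to `e ∈ [1, E]` with the indicator `e ∣ n`
  have hsupp : n.divisors.filter (fun e : ℕ => R < ((n / e : ℕ) : ℝ)) =
      (Finset.Icc 1 E).filter (fun e : ℕ => (e : ℤ) ∣ (n : ℤ) ∧ R * e < ((n : ℤ) : ℝ)) := by
    ext e
    simp only [Finset.mem_filter, Nat.mem_divisors, Finset.mem_Icc, Int.cast_natCast,
      Int.natCast_dvd_natCast]
    constructor
    · rintro ⟨⟨he, -⟩, hlt⟩
      have he1 : 1 ≤ e := Nat.pos_of_dvd_of_pos he (Nat.pos_of_ne_zero hn0)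
      have he0 : (0 : ℝ) < e := by exact_mod_cast he1
      rw [Nat.cast_div he he0.ne', lt_div_iff₀ he0] at hlt
      refine ⟨⟨he1, ?_⟩, he, hlt⟩
      have : (e : ℝ) < E := lt_of_mul_lt_mul_left (hlt.trans_le hnR) hR.le
      exact_mod_cast this.le
    · rintro ⟨⟨he1, -⟩, he, hlt⟩
      have he0 : (0 : ℝ) < e := by exact_mod_cast he1
      refine ⟨⟨he, hn0⟩, ?_⟩
      rwa [Nat.cast_div he he0.ne', lt_div_iff₀ he0]
  rw [← Finset.sum_filter, ← Finset.sum_filter, hsupp]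
  refine Finset.sum_congr rfl fun e he => ?_
  obtain ⟨he', hdvd, -⟩ := Finset.mem_filter.mp he
  have he1 : 1 ≤ e := (Finset.mem_Icc.mp he').1
  have he0 : (0 : ℝ) < e := by exact_mod_cast he1
  have hdvd' : e ∣ n := Int.natCast_dvd_natCast.mp hdvd
  have h1 : ((n : ℤ) / (e : ℤ)).toNat = n / e := by
    rw [← Int.natCast_div, Int.toNat_natCast]
  have h2 : ((n / e : ℕ) : ℝ) = (n : ℝ) / e := Nat.cast_div hdvd' he0.ne'
  have h3 : (0 : ℝ) < (n : ℝ) / e := div_pos (by exact_mod_cast Nat.pos_of_ne_zero hn0) he0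
  rw [h1, h2, ← Real.log_div h3.ne' hR.ne', div_div, Int.cast_natCast]


/-! ### Expanding the truncated factors `i > j` over tuples of divisors -/

/-- A product over `Ioi j` is a product over all indices with trivial factors off `Ioi j`. -/
theorem prod_Ioi_eq_prod_univ_ite {k : ℕ} (j : Fin (k + 1)) (f : Fin (k + 1) → ℝ) :
    ∏ i ∈ Finset.Ioi j, f i = ∏ i, if i ∈ Finset.Ioi j then f i else 1 := by
  rw [← Finset.prod_filter, Finset.filter_univ_mem]

/-- **The truncated factors over tuples.** For levels `R_i ≥ 0`:
`∏_{i > j} Λ_{R_i}(v_i) = ∑_{d} [∀ i > j, v_i > 0 ∧ d_i ∣ v_i] ∏_{i > j} μ(d_i) log(R_i/d_i)`, the sum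
over tuples `d : Fin (k+1) → ℕ` with `1 ≤ d_i ≤ ⌊R_i⌋` for `i > j` and `d_i = 1` for `i ≤ j`. -/
theorem prod_Ioi_lambdaR_eq_sum {k : ℕ} (j : Fin (k + 1)) (R : Fin (k + 1) → ℝ)
    (hR : ∀ i, 0 ≤ R i) (v : Fin (k + 1) → ℤ) :
    ∏ i ∈ Finset.Ioi j, lambdaR (R i) (v i) =
      ∑ d ∈ Fintype.piFinset (fun i => if i ∈ Finset.Ioi j then Finset.Icc 1 ⌊R i⌋₊ else {1}),
        if (∀ i ∈ Finset.Ioi j, (0 < v i ∧ (d i : ℤ) ∣ v i)) then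
          ∏ i ∈ Finset.Ioi j, (((ArithmeticFunction.moebius (d i) : ℤ) : ℝ) * Real.log (R i / d i))
        else 0 := by
  set t : Fin (k + 1) → Finset ℕ := fun i =>
    if i ∈ Finset.Ioi j then Finset.Icc 1 ⌊R i⌋₊ else {1} with ht
  set c : Fin (k + 1) → ℕ → ℝ := fun i x => if i ∈ Finset.Ioi j then
    (if (0 < v i ∧ (x : ℤ) ∣ v i) then ((ArithmeticFunction.moebius x : ℤ) : ℝ) * Real.log (R i / x)
      else 0) else 1 with hc
  have h1 : ∏ i ∈ Finset.Ioi j, lambdaR (R i) (v i) = ∏ i, ∑ x ∈ t i, c i x := by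
    rw [prod_Ioi_eq_prod_univ_ite]
    refine Finset.prod_congr rfl fun i _ => ?_
    by_cases hi : i ∈ Finset.Ioi j
    · rw [if_pos hi]
      simp only [ht, hc, if_pos hi]
      exact lambdaR_eq_sum_Icc (hR i) (v i)
    · rw [if_neg hi]
      simp only [ht, hc, if_neg hi, Finset.sum_singleton]
  rw [h1, Finset.prod_univ_sum]
  refine Finset.sum_congr rfl fun d _ => ?_
  have h2 : ∏ i, c i (d i) = ∏ i ∈ Finset.Ioi j, (if (0 < v i ∧ (d i : ℤ) ∣ v i) then
      ((ArithmeticFunction.moebius (d i) : ℤ) : ℝ) * Real.log (R i / d i) else 0) := by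
    rw [prod_Ioi_eq_prod_univ_ite]
  rw [h2, Finset.prod_ite_zero]
  by_cases h : ∀ i ∈ Finset.Ioi j, (0 < v i ∧ (d i : ℤ) ∣ v i)
  · rw [if_pos h, if_pos h]
  · rw [if_neg h, if_neg h]

/-! ### The exceptional value `ψ_j(n) = 1`: at most one point -/

/-- A non-constant progression takes each value at most once: `#{n ∈ s : a n + b = c} ≤ 1`. -/
theorem card_filter_affine_eq_le_one {a : ℤ} (ha : a ≠ 0) (b c : ℤ) (s : Finset ℤ) :
    (s.filter (fun n => a * n + b = c)).card ≤ 1 := by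
  refine Finset.card_le_one.mpr fun n hn n' hn' => ?_
  have h := (Finset.mem_filter.mp hn).2
  have h' := (Finset.mem_filter.mp hn').2
  have : a * (n - n') = 0 := by linear_combination h - h'
  rcases mul_eq_zero.mp this with h0 | h0
  · exact absurd h0 ha
  · linarith

end Summit.Parity.GeneralizedHardyLittlewood.Cruxes.RelativeDimOne.SingleMoebiusSplit
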